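import Summits.QuantumFields.BalabanUV.Beta.FP.SliceProjectorEntries

/-!
# `BalabanUV.Beta.FP.SliceProjectorAliasIndex` — road «FP» (binder row D1), organisation γ, row GAMMA-3 (c, estimate I): **THE RESIDUE-INDEX
# WEIGHT `j̃ = min(j+1, n−j)`, THE p-SERIES `Σ_{j∈ℤ_n} (j̃·j̃^ε)⁻¹ ≤ 2(1+ε⁻¹)` BY BERNOULLI TELESCOPING, AND THE RESIDUE-INDEX DECAY OF THE
# ALIAS «SQUARE ROOTS»: `‖gsum(±(k_l)_i) n‖ ≤ n·c₁/j̃(l_i)`, `‖qa_l‖, ‖qb_l‖ ≤ Π_i c₁/j̃(l_i)` ON THE FAT STRIP, EVERY `n ≥ 1`**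

HONEST FRAMING (cell contract, verbatim): «discharging `BetaPertH` makes Bałaban's UV stability UNCONDITIONAL — a real constructive-QFT
result; it is NOT the continuum limit and NOT the Clay problem.»  HONEST DEPENDENCY (verbatim): «continuum YM on T⁴ ⇐ BetaPertH ∧ nine
spine estimates (0/9 proved); BetaPertH ⇐ (D1) ∧ (D4) ∧ CAP+tail; G-an2-4 gates asym, D1 and NE2/3/4.»  THIS MODULE DISCHARGES NOTHING of
D1 ∕ BetaPertH: [folklore] elementary real analysis (Mathlib's Bernoulli `rpow_one_add_le_one_add_mul_self`, `Fin.revPerm` reflection) and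
the tree's `B4StripCauchy.shifted_sin_sq_ge` + gan24's `norm_gsum_le_of_im`∕`norm_gsum_le_inv_sin` BY NAME.  [our object] data defs `jt`, `c1`;
no `def … : Prop`; nothing is cited; 0 sorry.  NOT summit progress; NOT hbook, NOT D1, NOT BetaPertH, NOT continuum, NOT Clay.

ABSOLUTE RULE (cell, verbatim): «No internally-minted statement may enter as a cited fact. Every hypothesis is either kernel-proved in this
package or a verbatim quotation of a PUBLISHED theorem with page reference. The manuscript(s) under audit are NOT citable for their own
disputed steps — they are the thing under adjudication; programme-internal (2001/route/tribunal) claims are never citable.»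

CONTENT (`D = d+1`, fat strip `Fat D (rOf D)`):
* §1 `jt`, `one_le_jt`, `jt_pos`, `jt_of_val_zero`, `jt_eq_or`.
* §2 **`pseries_step`**, **`pseries_le`** (`Σ_{m<N} ((m+1)(m+1)^ε)⁻¹ ≤ 1 + ε⁻¹`, `0 < ε ≤ 1`), **`sum_inv_jt_rpow_le`**.
* §3 `jt_sq_le_sin` (`j̃² ≤ 8n² sin²((x+2πj)/(2n))`, `j ≠ 0`), `norm_gsum_le_jt`, `aliasPt_re_half`, `aliasPt_im_mul`,
  **`norm_gsum_aliasPt_le_jt`∕`norm_gsum_neg_aliasPt_le_jt`**, **`norm_qa_le_prod`∕`norm_qb_le_prod`**.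
Unit `b2b-balaban-beta-d1-formalise-leaf-06` (gen 8), organisation γ (R-FP-25), row GAMMA-3 (c); used by `SliceProjectorAliasSum` (estimate II + END).
-/

noncomputable section

namespace Summit.QuantumFields.BalabanUV.Beta.FP.SliceProjectorAliasIndex

open Complex Set Finset
open scoped BigOperators Real
open Literature.MathematicalPhysics.QuantumFieldTheory.Balaban1983to89
open B4Strip (Strip DeltaXi Sxi shift)
open B4StripCauchy (Fat rOf rOf_pos rOf_le shifted_sin_sq_ge)
open Summit.QuantumFields.BalabanUV.Beta.GAN24.FibreSymbols (gsum)
open Summit.QuantumFields.BalabanUV.Beta.GAN24.AliasDecimate (aliasPt)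
open Summit.QuantumFields.BalabanUV.Beta.GAN24.AliasStripSymbolsSum (norm_gsum_le_of_im norm_gsum_le_inv_sin)
open Summit.QuantumFields.BalabanUV.Beta.FP.CoarseCovarianceStripAliasWeights (aliasPt_apply' aliasPt_im)
open Summit.QuantumFields.BalabanUV.Beta.FP.SliceProjectorEntries

variable {d : ℕ}
/-! ## §1 The residue-index weight `j̃ = min(j+1, n−j)` -/

/-- [our object] the residue-index weight `jt n j := min (j+1) (n−j)` (real; `≥ 1`, `= 1` at `j = 0`). -/
def jt (n : ℕ) (j : Fin n) : ℝ := min (((j : ℕ) : ℝ) + 1) ((n : ℝ) - (j : ℕ))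

/-- [folklore] `1 ≤ j̃`. -/
theorem one_le_jt {n : ℕ} (j : Fin n) : 1 ≤ jt n j := by
  have hj : (j : ℕ) + 1 ≤ n := j.isLt
  have h1 : ((j : ℕ) : ℝ) + 1 ≤ n := by exact_mod_cast hj
  have h0 : (0 : ℝ) ≤ (j : ℕ) := Nat.cast_nonneg _
  unfold jt
  exact le_min (by linarith) (by linarith)

/-- [folklore] `0 < j̃`. -/
theorem jt_pos {n : ℕ} (j : Fin n) : 0 < jt n j := lt_of_lt_of_le one_pos (one_le_jt j)

/-- [folklore] `j̃ = 1` when `j = 0`. -/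
theorem jt_of_val_zero {n : ℕ} {j : Fin n} (hj : (j : ℕ) = 0) : jt n j = 1 := by
  have hn : (1 : ℝ) ≤ n := by exact_mod_cast (show 1 ≤ n by have := j.isLt; omega)
  unfold jt
  rw [hj, Nat.cast_zero, zero_add, sub_zero]
  exact min_eq_left hn

/-- [folklore] `j̃` is one of `j+1`, `n−j`. -/
theorem jt_eq_or {n : ℕ} (j : Fin n) : jt n j = ((j : ℕ) : ℝ) + 1 ∨ jt n j = (n : ℝ) - (j : ℕ) := min_choice _ _

/-! ## §2 The p-series by Bernoulli telescoping -/

/-- [folklore] the telescoping step: `((x+1)·(x+1)^ε)⁻¹ ≤ ε⁻¹·((x^ε)⁻¹ − ((x+1)^ε)⁻¹)` for `x ≥ 1`, `0 < ε ≤ 1`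
(Bernoulli `(1 − 1/(x+1))^ε ≤ 1 − ε/(x+1)`). -/
theorem pseries_step {x ε : ℝ} (hx : 1 ≤ x) (hε0 : 0 < ε) (hε1 : ε ≤ 1) :
    ((x + 1) * (x + 1) ^ ε)⁻¹ ≤ ε⁻¹ * ((x ^ ε)⁻¹ - ((x + 1) ^ ε)⁻¹) := by
  have hx0 : 0 < x := by linarith
  have hx1 : 0 < x + 1 := by linarith
  have hA0 : 0 < x ^ ε := Real.rpow_pos_of_pos hx0 ε
  have hB0 : 0 < (x + 1) ^ ε := Real.rpow_pos_of_pos hx1 ε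
  have hAB : x ^ ε ≤ (x + 1) ^ ε := Real.rpow_le_rpow hx0.le (by linarith) hε0.le
  have hs : (-1 : ℝ) ≤ -1 / (x + 1) := by
    rw [neg_div, neg_le_neg_iff, div_le_one hx1]; linarith
  have hbern := rpow_one_add_le_one_add_mul_self hs hε0.le hε1
  have h1s : 1 + -1 / (x + 1) = x / (x + 1) := by field_simp; ring
  rw [h1s, Real.div_rpow hx0.le hx1.le] at hbern
  have key : ε / (x + 1) ≤ 1 - x ^ ε / (x + 1) ^ ε := by
    have h : ε * (-1 / (x + 1)) = -(ε / (x + 1)) := by ring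
    rw [h] at hbern; linarith
  have key2 : ε ≤ (1 - x ^ ε / (x + 1) ^ ε) * (x + 1) := (div_le_iff₀ hx1).1 key
  have key3 : 1 - x ^ ε / (x + 1) ^ ε ≤ ((x + 1) ^ ε - x ^ ε) / x ^ ε := by
    rw [show 1 - x ^ ε / (x + 1) ^ ε = ((x + 1) ^ ε - x ^ ε) / (x + 1) ^ ε by field_simp]
    exact div_le_div_of_nonneg_left (by linarith) hA0 hAB
  have hfin : ε * x ^ ε ≤ ((x + 1) ^ ε - x ^ ε) * (x + 1) := by
    have h := key2.trans (mul_le_mul_of_nonneg_right key3 hx1.le)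
    rwa [div_mul_eq_mul_div, le_div_iff₀ hA0] at h
  rw [show ε⁻¹ * ((x ^ ε)⁻¹ - ((x + 1) ^ ε)⁻¹) = (((x + 1) ^ ε - x ^ ε) * (x + 1)) / (ε * x ^ ε * ((x + 1) * (x + 1) ^ ε)) by
      field_simp,
    show ((x + 1) * (x + 1) ^ ε)⁻¹ = (ε * x ^ ε) / (ε * x ^ ε * ((x + 1) * (x + 1) ^ ε)) by
      field_simp]
  exact div_le_div_of_nonneg_right hfin (by positivity)

/-- [folklore] **THE p-SERIES**: `Σ_{m<N} ((m+1)·(m+1)^ε)⁻¹ ≤ 1 + ε⁻¹` for `0 < ε ≤ 1`, every `N`. -/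
theorem pseries_le {ε : ℝ} (hε0 : 0 < ε) (hε1 : ε ≤ 1) (N : ℕ) :
    ∑ m ∈ Finset.range N, (((m : ℝ) + 1) * ((m : ℝ) + 1) ^ ε)⁻¹ ≤ 1 + ε⁻¹ := by
  have hε := inv_pos.2 hε0
  rcases Nat.eq_zero_or_pos N with h0 | hpos
  · subst h0; simp only [Finset.range_zero, Finset.sum_empty]; positivity
  · have key : ∀ M : ℕ, 1 ≤ M →
        ∑ m ∈ Finset.range M, (((m : ℝ) + 1) * ((m : ℝ) + 1) ^ ε)⁻¹ ≤ 1 + ε⁻¹ * (1 - (((M : ℝ)) ^ ε)⁻¹) := by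
      intro M hM
      induction M, hM using Nat.le_induction with
      | base => simp
      | succ M hM ih =>
        rw [Finset.sum_range_succ]
        have hstep := pseries_step (x := (M : ℝ)) (by exact_mod_cast hM) hε0 hε1
        push_cast
        calc _ ≤ 1 + ε⁻¹ * (1 - ((M : ℝ) ^ ε)⁻¹) + ε⁻¹ * (((M : ℝ) ^ ε)⁻¹ - (((M : ℝ) + 1) ^ ε)⁻¹) := add_le_add ih hstep
          _ = 1 + ε⁻¹ * (1 - (((M : ℝ) + 1) ^ ε)⁻¹) := by ring
    have hN : 0 ≤ (((N : ℝ)) ^ ε)⁻¹ := by positivity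
    calc _ ≤ 1 + ε⁻¹ * (1 - (((N : ℝ)) ^ ε)⁻¹) := key N hpos
      _ ≤ 1 + ε⁻¹ := by nlinarith

/-- [folklore] **THE RESIDUE-INDEX SUM**: `Σ_{j ∈ ℤ_n} (j̃·j̃^ε)⁻¹ ≤ 2(1 + ε⁻¹)` for `0 < ε ≤ 1`, every `n` (split `j̃ ∈ {j+1, n−j}`, reflect). -/
theorem sum_inv_jt_rpow_le (n : ℕ) {ε : ℝ} (hε0 : 0 < ε) (hε1 : ε ≤ 1) :
    ∑ j : Fin n, (jt n j * jt n j ^ ε)⁻¹ ≤ 2 * (1 + ε⁻¹) := by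
  have hterm : ∀ j : Fin n, (jt n j * jt n j ^ ε)⁻¹
      ≤ ((((j : ℕ) : ℝ) + 1) * (((j : ℕ) : ℝ) + 1) ^ ε)⁻¹ + (((n : ℝ) - (j : ℕ)) * ((n : ℝ) - (j : ℕ)) ^ ε)⁻¹ := by
    intro j
    have hj : (j : ℕ) + 1 ≤ n := j.isLt
    have h1 : (0 : ℝ) < ((j : ℕ) : ℝ) + 1 := by positivity
    have h2 : (0 : ℝ) < (n : ℝ) - (j : ℕ) := by
      have : ((j : ℕ) : ℝ) + 1 ≤ n := by exact_mod_cast hj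
      linarith
    have hp1 : 0 ≤ ((((j : ℕ) : ℝ) + 1) * (((j : ℕ) : ℝ) + 1) ^ ε)⁻¹ := by positivity
    have hp2 : 0 ≤ (((n : ℝ) - (j : ℕ)) * ((n : ℝ) - (j : ℕ)) ^ ε)⁻¹ :=
      (inv_pos.2 (mul_pos h2 (Real.rpow_pos_of_pos h2 ε))).le
    rcases jt_eq_or j with h | h <;> rw [h]
    · linarith
    · linarith
  refine (Finset.sum_le_sum fun j _ => hterm j).trans ?_
  rw [Finset.sum_add_distrib]
  have hrefl : ∑ j : Fin n, (((n : ℝ) - (j : ℕ)) * ((n : ℝ) - (j : ℕ)) ^ ε)⁻¹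
      = ∑ j : Fin n, ((((j : ℕ) : ℝ) + 1) * (((j : ℕ) : ℝ) + 1) ^ ε)⁻¹ := by
    refine Fintype.sum_equiv Fin.revPerm _ _ (fun j => ?_)
    have hj : (j : ℕ) + 1 ≤ n := j.isLt
    have e : (((Fin.revPerm j : Fin n) : ℕ) : ℝ) + 1 = (n : ℝ) - (j : ℕ) := by
      rw [Fin.revPerm_apply, Fin.val_rev, Nat.cast_sub hj]; push_cast; ring
    rw [e]
  rw [hrefl, Fin.sum_univ_eq_sum_range (fun m => (((m : ℝ) + 1) * ((m : ℝ) + 1) ^ ε)⁻¹) n]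
  have := pseries_le hε0 hε1 n
  linarith

/-! ## §3 Per-alias-index bounds on the fat strip -/

/-- [our object] the one-coordinate constant `c₁ := 3e²`. -/
def c1 : ℝ := 3 * Real.exp 2

/-- [folklore] `0 < c₁`. -/
theorem c1_pos : 0 < c1 := by unfold c1; positivity

/-- [folklore] fat-strip coordinates: `|Re p_i| ≤ π + r`, `|Im p_i| ≤ 1`. -/
theorem fat_facts {p : Fin (d + 1) → ℂ} (hp : p ∈ Fat (d + 1) (rOf (d + 1))) (i : Fin (d + 1)) :
    |(p i).re| ≤ Real.pi + rOf (d + 1) ∧ |(p i).im| ≤ 1 :=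
  ⟨(hp i).1, (hp i).2.trans (by linarith [rOf_le (d + 1)])⟩

/-- [folklore] **RESIDUE-INDEX DECAY OF THE SHIFTED SINE**: `j̃² ≤ 8n²·sin²((x + 2πj)/(2n))` for `j ≠ 0`, `|x| ≤ π + r` (`shifted_sin_sq_ge`). -/
theorem jt_sq_le_sin (n : ℕ) {x : ℝ} (hx : |x| ≤ Real.pi + rOf (d + 1)) (j : Fin n) (hj : (j : ℕ) ≠ 0) :
    jt n j ^ 2 ≤ 8 * (n : ℝ) ^ 2 * Real.sin ((x + 2 * Real.pi * (j : ℕ)) / (2 * n)) ^ 2 := by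
  have hj1 : 1 ≤ (j : ℕ) := Nat.one_le_iff_ne_zero.mpr hj
  have hjn : (j : ℕ) + 1 ≤ n := j.isLt
  have h := (shifted_sin_sq_ge n j hj1 hjn (rOf_le (d + 1)) hx).2
  have h0 := one_le_jt j
  have ha : jt n j ≤ ((j : ℕ) : ℝ) + 1 := min_le_left _ _
  have hb : jt n j ≤ (n : ℝ) - (j : ℕ) := min_le_right _ _
  rcases h with h | h
  · nlinarith [mul_self_le_mul_self (by linarith) ha]
  · nlinarith [mul_self_le_mul_self (by linarith) hb]

/-- [folklore] the core `gsum` bound: `|Im w|·n ≤ 1` and `|sin(Re w/2)| = |sin((Re p_i + 2π l_i)/(2n))|` give `‖gsum w n‖ ≤ n·c₁/j̃(l_i)`. -/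
theorem norm_gsum_le_jt (n : ℕ) [NeZero n] {p : Fin (d + 1) → ℂ} (hp : p ∈ Fat (d + 1) (rOf (d + 1)))
    (l : Fin (d + 1) → Fin n) (i : Fin (d + 1)) {w : ℂ} (hρ : |w.im| * n ≤ 1)
    (hre : |Real.sin (w.re / 2)| = |Real.sin (((p i).re + 2 * Real.pi * ((l i : ℕ) : ℝ)) / (2 * n))|) :
    ‖gsum w n‖ ≤ n * (c1 / jt n (l i)) := by
  have hn : (0 : ℝ) < n := by exact_mod_cast Nat.pos_of_ne_zero (NeZero.ne n)
  have hjt := jt_pos (l i)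
  have he2 := Real.exp_pos (2 : ℝ)
  by_cases h0 : ((l i : ℕ)) = 0
  · rw [jt_of_val_zero h0, div_one]
    refine (norm_gsum_le_of_im _ n hρ).trans (mul_le_mul_of_nonneg_left ?_ hn.le)
    unfold c1
    have := Real.exp_le_exp.2 (show (1 : ℝ) ≤ 2 by norm_num)
    linarith
  · have hsin := jt_sq_le_sin n (fat_facts hp i).1 (l i) h0
    set s := Real.sin (((p i).re + 2 * Real.pi * ((l i : ℕ) : ℝ)) / (2 * n)) with hs
    have hs0 : s ≠ 0 := by
      intro h; rw [h] at hsin; nlinarith [one_le_jt (l i)]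
    have hspos : 0 < |s| := abs_pos.2 hs0
    have hw0 : Real.sin (w.re / 2) ≠ 0 := fun h => by rw [h, abs_zero] at hre; exact hspos.ne' hre.symm |>.elim
    have h1 := norm_gsum_le_inv_sin hρ hw0
    rw [hre] at h1
    refine h1.trans ?_
    have hjs : jt n (l i) ≤ 3 * n * |s| := by
      have : jt n (l i) ^ 2 ≤ (3 * n * |s|) ^ 2 := by rw [mul_pow, sq_abs]; nlinarith [sq_nonneg s]
      exact (pow_le_pow_iff_left₀ hjt.le (by positivity) two_ne_zero).1 this
    have h13 : (1 : ℝ) ≤ 3 * n * |s| / jt n (l i) := (one_le_div hjt).2 hjs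
    rw [div_le_iff₀ hspos]
    calc Real.exp (2 * 1) = Real.exp 2 * 1 := by norm_num
      _ ≤ Real.exp 2 * (3 * n * |s| / jt n (l i)) := mul_le_mul_of_nonneg_left h13 he2.le
      _ = n * (c1 / jt n (l i)) * |s| := by unfold c1; ring

/-- [folklore] the real part of an alias momentum, halved: `Re (k_l)_i / 2 = (Re p_i + 2π l_i)/(2n)`. -/
theorem aliasPt_re_half (n : ℕ) [NeZero n] (l : Fin (d + 1) → Fin n) (p : Fin (d + 1) → ℂ) (i : Fin (d + 1)) :
    (aliasPt n l p i).re / 2 = ((p i).re + 2 * Real.pi * ((l i : ℕ) : ℝ)) / (2 * n) := by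
  have hn : (n : ℝ) ≠ 0 := Nat.cast_ne_zero.mpr (NeZero.ne n)
  rw [aliasPt_apply', Complex.div_natCast_re]
  simp only [Complex.add_re, Complex.mul_re, Complex.ofReal_re, Complex.ofReal_im, Complex.natCast_re, Complex.natCast_im,
    Complex.re_ofNat, Complex.im_ofNat, mul_zero, sub_zero]
  field_simp

/-- [folklore] `|Im (k_l)_i|·n = |Im p_i| ≤ 1` on the fat strip. -/
theorem aliasPt_im_mul (n : ℕ) [NeZero n] {p : Fin (d + 1) → ℂ} (hp : p ∈ Fat (d + 1) (rOf (d + 1)))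
    (l : Fin (d + 1) → Fin n) (i : Fin (d + 1)) : |(aliasPt n l p i).im| * n ≤ 1 := by
  have hn : (n : ℝ) ≠ 0 := Nat.cast_ne_zero.mpr (NeZero.ne n)
  rw [aliasPt_im, abs_div, Nat.abs_cast, div_mul_cancel₀ _ hn]
  exact (fat_facts hp i).2

/-- [folklore] **`‖gsum (k_l)_i n‖ ≤ n·c₁/j̃(l_i)`** on the fat strip. -/
theorem norm_gsum_aliasPt_le_jt (n : ℕ) [NeZero n] {p : Fin (d + 1) → ℂ} (hp : p ∈ Fat (d + 1) (rOf (d + 1)))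
    (l : Fin (d + 1) → Fin n) (i : Fin (d + 1)) : ‖gsum (aliasPt n l p i) n‖ ≤ n * (c1 / jt n (l i)) :=
  norm_gsum_le_jt n hp l i (aliasPt_im_mul n hp l i) (by rw [aliasPt_re_half])

/-- [folklore] **`‖gsum (−(k_l)_i) n‖ ≤ n·c₁/j̃(l_i)`** on the fat strip. -/
theorem norm_gsum_neg_aliasPt_le_jt (n : ℕ) [NeZero n] {p : Fin (d + 1) → ℂ} (hp : p ∈ Fat (d + 1) (rOf (d + 1)))
    (l : Fin (d + 1) → Fin n) (i : Fin (d + 1)) : ‖gsum (-(aliasPt n l p i)) n‖ ≤ n * (c1 / jt n (l i)) :=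
  norm_gsum_le_jt n hp l i (by rw [Complex.neg_im, abs_neg]; exact aliasPt_im_mul n hp l i)
    (by rw [Complex.neg_re, neg_div, Real.sin_neg, abs_neg, aliasPt_re_half])

/-- [folklore] **`‖qa_l‖ ≤ Π_i c₁/j̃(l_i)`** on the fat strip. -/
theorem norm_qa_le_prod (n : ℕ) [NeZero n] {p : Fin (d + 1) → ℂ} (hp : p ∈ Fat (d + 1) (rOf (d + 1)))
    (l : Fin (d + 1) → Fin n) : ‖qa n l p‖ ≤ ∏ i, c1 / jt n (l i) := by
  have hn : (0 : ℝ) < n := by exact_mod_cast Nat.pos_of_ne_zero (NeZero.ne n)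
  rw [qa, norm_mul, norm_inv, norm_pow, Complex.norm_natCast, norm_prod]
  calc ((n : ℝ) ^ (d + 1))⁻¹ * ∏ i, ‖gsum (aliasPt n l p i) n‖ ≤ ((n : ℝ) ^ (d + 1))⁻¹ * ∏ i, ((n : ℝ) * (c1 / jt n (l i))) :=
        mul_le_mul_of_nonneg_left (Finset.prod_le_prod (fun i _ => norm_nonneg _) fun i _ => norm_gsum_aliasPt_le_jt n hp l i)
          (by positivity)
    _ = ∏ i, c1 / jt n (l i) := by
        rw [Finset.prod_mul_distrib, Finset.prod_const, Finset.card_univ, Fintype.card_fin, ← mul_assoc,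
          inv_mul_cancel₀ (pow_ne_zero _ hn.ne'), one_mul]

/-- [folklore] **`‖qb_l‖ ≤ Π_i c₁/j̃(l_i)`** on the fat strip. -/
theorem norm_qb_le_prod (n : ℕ) [NeZero n] {p : Fin (d + 1) → ℂ} (hp : p ∈ Fat (d + 1) (rOf (d + 1)))
    (l : Fin (d + 1) → Fin n) : ‖qb n l p‖ ≤ ∏ i, c1 / jt n (l i) := by
  have hn : (0 : ℝ) < n := by exact_mod_cast Nat.pos_of_ne_zero (NeZero.ne n)
  rw [qb, norm_mul, norm_inv, norm_pow, Complex.norm_natCast, norm_prod]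
  calc ((n : ℝ) ^ (d + 1))⁻¹ * ∏ i, ‖gsum (-(aliasPt n l p i)) n‖ ≤ ((n : ℝ) ^ (d + 1))⁻¹ * ∏ i, ((n : ℝ) * (c1 / jt n (l i))) :=
        mul_le_mul_of_nonneg_left (Finset.prod_le_prod (fun i _ => norm_nonneg _) fun i _ => norm_gsum_neg_aliasPt_le_jt n hp l i)
          (by positivity)
    _ = ∏ i, c1 / jt n (l i) := by
        rw [Finset.prod_mul_distrib, Finset.prod_const, Finset.card_univ, Fintype.card_fin, ← mul_assoc,
          inv_mul_cancel₀ (pow_ne_zero _ hn.ne'), one_mul]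

end Summit.QuantumFields.BalabanUV.Beta.FP.SliceProjectorAliasIndex

end
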